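import Mathlib
import HarnessLib
import HarnessLib.Audit
import Summits.ABC.Statement
import Literature.Barriers.ABC.BakerMethodBoundsStewartYu1991LineRestrictedProofs
import Literature.Barriers.ABC.BakerMethodBoundsEpsShape
import Literature.Barriers.ABC.BakerMethodBounds
import HarnessLib.Audit.Status.Attr

/-!
Route: PadicPrimesW80TwoThirds

CLOSED (proved) 2026-08-26T14:14:11Z by operator:999:1382907 — reason: proved:Summit.ABC.ABC.Theorems.stewartYu1991_holds. The file is kept as the record of this route; refuted decls are indexed as negative knowledge (`ledger negatives`).

# Route PadicPrimesW80TwoThirds — Stewart–Yu 1991 (rad^(2/3+ε)) from Waldschmidt-binder p-adic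
bounds for rational primes in the three residue classes, through the LANDED restricted Stewart–Yu
door

RUNG ROUTE A1.M2, RE-TARGETED DECOMPOSITION (D-0059/D-0061, class rung, never summit credit;
decision (i) of 2026-08-26T06:18Z,
door corrected 06:4xZ on p3-g2's 06:31Z line): it suffices to show, in each of the three classes p ≡
3 (mod 4), p ≡ 1 (mod 4),
p = 2, the p-adic estimate for rational primes with Yu 1990's quality (c₅ n)ⁿ·p² and WALDSCHMIDT
1980's binder
(log B + log log A)·log log A (cruxes W80ThreeModFour, W80OneModFour, W80Two — verbatim the
conclusions of the tree's
`residueClass_of_w80Engine` transfers from the unit-form engine the landed CW77/W80 architecture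
outputs, p2 memo-04 §3), because
Stewart–Yu 1991 §3 applies its Lemma 1 only where log log A ≤ log B (B = 6 log c, A ≤ G ≤ c³), so
the weaker binder costs a
factor 2 in c₅: the door `Literature.Barriers.ABC.stewartYu1991_of_w80Shape` is IN THE TREE
(p427924, 855 lines, 0 sorries).
No new door, no κ-door bricks; the glue merges the three constants. Supersedes route
PadicPrimesKappaDoorTwoThirds (same rung,
three-slot κ-door as an avoidable 1 kLoC crux); route PadicPrimesYuNinety (Yu binder) stays as
fallback PATH Y′.
Lean: `∃ c₅ : ℝ, ∀ (p : ℕ), p.Prime → p % 4 = 3 → ∀ (S : Finset ℕ), (∀ q ∈ S, q.Prime) → p ∉ S →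
S.Nonempty → ∀ (e : ℕ → ℤ) (B : ℝ), 3 ≤ B → (∀ q ∈ S, (|e q| : ℝ) ≤ B) → ∏ q ∈ S, (q : ℚ) ^ e q ≠ 1
→ (padicValRat p (∏ q ∈ S, (q : ℚ) ^ e q - 1) : ℝ) < (c₅ * S.card) ^ S.card * (p : ℝ) ^ 2 *
((Real.log B + Real.log (Real.log ((max 4 (S.sup id) : ℕ) : ℝ))) * Real.log (Real.log ((max 4 (S.sup
id) : ℕ) : ℝ))) * ∏ q ∈ S, Real.log ((max 4 q : ℕ) : ℝ)`

## Assembly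
Pure logic + monotonicity in c₅ (`glueM2W.lean`, farm rc 0 / 0 sorries in the planner's
w80/SketchM2W.lean): c₅ := max(|c₃|,|c₁|,|c₂|),
case split p = 2 / p ≡ 1 / p ≡ 3 (mod 4), then `stewartYu1991_of_w80Shape`.

CLOSES_TARGET: closes rung F-A1.M2 of ABC: Literature.Barriers.ABC.stewartYu1991_upperBound (D-0061; not the summit Statement) — the deciding theorem of this route concludes that registered leaf instead of the Statement decl `ABC` (class rung: servable and labelled, never counted as concluding the summit Statement).

Rationale: WHY THIS LINE. Mechanism: the rung is rad^(2/3+ε); in Stewart–Yu 1991 §3 [StewartYu1991 (8)–(18)]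
the p-adic Lemma 1 is used with B = 6 log c
and A ≤ rad ≤ c³, where (log B + log log A)·log log A ≤ 2 log B·log log A, so Waldschmidt's binder
[Waldschmidt1980 Prop. 3.8;
tree PadicW80Par] is as good as Yu's [Yu1990 Cor. 2.3] for this rung (p3-g2's restricted door,
landed). The p-adic inputs are
Yu's twisted auxiliary function [Yu1990 §2] on the landed Cijsouw–Waldschmidt machine in log-p units
(p2 memo-04: plain
derivatives force W⋆ ⊇ log V, hence this binder and not Yu's). Imported: nothing outside the Baker
class. Every statement here is
the exact output type of a tree transfer (`threeModFour_of_w80Engine`, `oneModFour_of_w80Engine`;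
2-adic analogue to write), so
each crux closes by one line from its engine.

RANKED CRUXES. #2 W80ThreeModFour (crux) — there is c₅ such that for every prime p with p ≡ 3 (mod
4), every finite set S of primes q ≠ p (S ≠ ∅), exponents |e_q| ≤ B (B ≥ 3) with ∏q^(e_q) ≠ 1:
ord_p(∏_{q∈S} q^(e_q) − 1) < (c₅·#S)^#S · p² · (log B + log log A)·log log A · ∏_{q∈S} log max(4,q),
A = max(4, max S) — Yu 1990's quality (c n)ⁿ·p² with WALDSCHMIDT 1980's binder (W + log V)·log V;
verbatim the conclusion of the tree's `Summit.ABC.StewartYu.YuNinetyW80.residueClass_of_w80Engine`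
(p428501) and the binder of the landed door `Literature.Barriers.ABC.stewartYu1991_of_w80Shape`
(p427924). Line (lead p2-g2, PATH Z, memo-04 §3): the K = ℚ Teichmüller-twist engine on the LANDED
CW77/W80 architecture in log-p units (PadicTwistSetup p428006, PadicTwistValues p428445 landed;
Functions/Series/KStep/Main staged; half-step provider A = QR-normalisation in ℚ_p; TwistW80Par;
log-p sizes) ⇒ unit-form engine ⇒ this text by `threeModFour_of_w80Engine` (tree). [difficulty: XL]
(why it might fail: Engine Z is unbuilt (≈ 6.5 kLoC): the class price (p−1)/2, the W-floor log p and
one log log p must fit p² (p3: (log p)² ≤ 4p pays), and the (log p)-unit W80 numerics (S5, p1-g4)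
must close for every m; a failure restates the binder.) [Yu1990, Waldschmidt1980, StewartYu1991]
#3 W80Two (crux) — there is c₅ such that at p = 2, every finite set S of primes q ≠ p (S ≠ ∅),
exponents |e_q| ≤ B (B ≥ 3) with ∏q^(e_q) ≠ 1: ord_p(∏_{q∈S} q^(e_q) − 1) < (c₅·#S)^#S · p² · (log B
+ log log A)·log log A · ∏_{q∈S} log max(4,q), A = max(4, max S) — Yu 1990's quality (c n)ⁿ·p² with
WALDSCHMIDT 1980's binder (W + log V)·log V; verbatim the conclusion of the tree's
`Summit.ABC.StewartYu.YuNinetyW80.residueClass_of_w80Engine` (p428501) and the binder of the landed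
door `Literature.Barriers.ABC.stewartYu1991_of_w80Shape` (p427924). Line (WP-Y2 on the landed
architecture): principal units αⱼ = qⱼ² ≡ 1 (mod 8), q = 3 descent over ℚ (∛α ∈ ℤ₂ by Hensel; 3^m
classes; third-point Liouville by the cubic norm form — lit p421796/p424483, p1 bricks
p422573/p423648), f log p = log 2, then a 2-adic analogue of `residueClass_of_w80Engine`.
[difficulty: XL] (why it might fail: The 2-adic engine is unbuilt (≈ 4–5 kLoC): radius-2 Schwarz
constants (exp/log only on ord₂ ≥ 2/3... via squares ≡ 1 mod 8), the Siegel count and endgame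
numerics at p = 2 with 3^m classes and cubic norms may not close inside (c·n)ⁿ; generators qⱼ² cost
2ⁿ only.) [Yu1990, StewartYu1991, Waldschmidt1980]
#4 W80OneModFour (crux) — there is c₅ such that for every prime p with p ≡ 1 (mod 4), every finite
set S of primes q ≠ p (S ≠ ∅), exponents |e_q| ≤ B (B ≥ 3) with ∏q^(e_q) ≠ 1: ord_p(∏_{q∈S} q^(e_q)
− 1) < (c₅·#S)^#S · p² · (log B + log log A)·log log A · ∏_{q∈S} log max(4,q), A = max(4, max S) —
Yu 1990's quality (c n)ⁿ·p² with WALDSCHMIDT 1980's binder (W + log V)·log V; verbatim the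
conclusion of the tree's `Summit.ABC.StewartYu.YuNinetyW80.residueClass_of_w80Engine` (p428501) and
the binder of the landed door `Literature.Barriers.ABC.stewartYu1991_of_w80Shape` (p427924). Line:
the same engine with p3-g2's parity-bit half-step outside ℚ_p (classes mod (p−1)/2 + one bit;
Liouville over ℚ(ι,√α) in ℂ_[p]: PadicComplexLiouville p425563, TwistHalfPointAlgebra p427086
landed) ⇒ text by `oneModFour_of_w80Engine` (tree). [difficulty: L] (why it might fail: Same engine
plus the half-step OUTSIDE ℚ_p (ξ² = ζ has no root in ℚ_p at p ≡ 1 mod 4): fails if the PadicComplex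
norm API cannot carry the half-step sizes inside the landed Main's HalfStep interface, or if the
class-bit bookkeeping doubles T beyond the numerics.) [Yu1990, Waldschmidt1980]

TWO-LAYER PLAN. Foreseen glued split of each crux into ⟨unit-form engine (the lead's stub: ∃ C c₁, …
ord_p(∏αⱼ^bⱼ − 1) ≤ C(m)·p·∏(Vⱼ/log p)·
(W + log 2Vmax)·log 2Vmax, the hE binder of `residueClass_of_w80Engine` verbatim)⟩ + ⟨transfer
(tree, one line)⟩ when the lead
registers its skeleton. The Fin-form cruxes of route PadicPrimesYuNinetyOddRadOne
(stmt-ABC-19455/19456, rung rad^(1+ε)) follow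
from W80ThreeModFour/W80OneModFour by `YuNinetyW80Kappa.finBoundAt_of_residueClass_aux` (p428600) —
one engine per class serves both rungs.

KILL CRITERIA. A counterexample to a text at small (#S, p) (numerics) restates the binder; an
engine-output mismatch with the hE binder of
`residueClass_of_w80Engine` (e.g. a second log log p, or V-floors not in log-p units) is repaired in
the transfer, not here.
The rung is a theorem in print; only typed shapes can die. Fallbacks: κ-door route shape (closed
superseded, re-openable), PATH Y′.

NOT DECOMPOSED YET. The engines (layers = skeleton stubs of the leads, not items): Z (p2:
Functions/Series/KStep/Main twins, provider A, TwistW80Par,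
sizes), provider B (p3), the 2-adic q = 3 engine (p1/p4), S5 numerics (p1-g4).

CHEAPEST FALSIFIER. The one-prime case (card S = 1): ord_p(q^e − 1) < c₅·p²·(log B + log log
max(4,q))·log log max(4,q)·log max(4,q) from the one-logarithm lemma — the Yu-binder
rungs `yuNinety*_rung` (p419359, tree) imply these at #S = 1 in three lines (BC5 rung WANTED
`w80ThreeModFour_card_one`); and the
glue (done, rc 0).

NUMBERS. Exponent 2/3 + ε; c₅(route) = max |c₅(class)|; door factor 2 (c₅ ↦ 2|c₅|). Sizes/ETAs
(D-0071): W80ThreeModFour ≈ 6.5 kLoC (p2+p3,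
2026-08-29/30); W80OneModFour ≈ 1 kLoC delta (p3, 2026-08-31); W80Two ≈ 4–5 kLoC (p1 or p4,
2026-09-01/02). Rung ETA = W80Two's.

Novelty: Searches run: `lean search --decl stewartYu1991_of_w80Shape` (tree, p427924), `lean search
'of_w80Engine'` (tree transfers),
`ledger negatives --problem ABC` (no statement of this shape), `lit search --hybrid "Waldschmidt
1980 p-adic linear forms log B log log A"`,
`lit search --hybrid "Stewart Yu 1991 abc two thirds Lemma 1 applied with B = 6 log c"`. Nearest
prior art found: StewartYu1991 (the rung),
Yu1990 Cor. 2.3, Waldschmidt1980; routes PadicPrimesYuNinety (Yu binder) and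
PadicPrimesKappaDoorTwoThirds (κ-door). Delta: the cruxes
are the exact output types of the formalised architecture's transfers and the door is already a
theorem — grade expected known/variant (rung record).  [refs: StewartYu1991, Yu1990, Waldschmidt1980]

Barriers (technique_class: baker-linear-forms, kummer-theory): - technique_class: baker-linear-forms, kummer-theory
- Literature.Barriers.ABC.BakerMethodBounds (Baker-class bounds are exponential in rad): it does not
evade it; the bet is a RUNG inside the class (log c ≪ rad^(2/3+ε) = Stewart–Yu 1991), class rung,
never summit credit.

History (route lifecycle, newest last):
- 2026-08-26T14:14:11Z · CLOSED proved — proved:Summit.ABC.ABC.Theorems.stewartYu1991_holds (operator:999:1382907)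

sub-problem: ABC · status: closed(proved) · opened planner-abc-stewartyu-plan-g4-0 2026-08-26T06:44:19Z · rev 0 · ledger route-ABC-PadicPrimesW80TwoThirds
GENERATED by the gate from the ledger (D-0016/17). Provers cite these decls: `theorem foo : Summit.ABC.ABC.Theses.PadicPrimesW80TwoThirds.<Decl> := …` in Summits/ABC/ABC/Theorems/<Name>.lean.
-/

namespace Summit.ABC.ABC.Theses.PadicPrimesW80TwoThirds

open scoped BigOperators Topology Manifold Classical MeasureTheory ProbabilityTheory Matrix InnerProductSpace ComplexConjugate ContinuousMap
open Filter Set Function TopologicalSpace MeasureTheory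

attribute [summit_statement] _root_.ABC
attribute [summit_statement] _root_.Literature.Barriers.ABC.stewartYu1991_upperBound

open Literature.Abc

/-- item stmt-ABC-19485 · crux · rank 2 · closed · proved by Summit.ABC.ABC.Theorems.padicPrimesW80TwoThirds_w80ThreeModFour_proof (prover) · by planner
why it might fail: Engine Z is unbuilt (≈ 6.5 kLoC): the class price (p−1)/2, the W-floor log p and one log log p must fit p² (p3: (log p)² ≤ 4p pays), and the (log p)-unit W80 numerics (S5, p1-g4) must close for every m; a failure restates the binder.
sources: Yu1990, Waldschmidt1980, StewartYu1991
[crux] there is c₅ such that for every prime p with p ≡ 3 (mod 4), every finite set S of primes q ≠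
p (S ≠ ∅), exponents |e_q| ≤ B (B ≥ 3) with ∏q^(e_q) ≠ 1: ord_p(∏_{q∈S} q^(e_q) − 1) < (c₅·#S)^#S ·
p² · (log B + log log A)·log log A · ∏_{q∈S} log max(4,q), A = max(4, max S) — Yu 1990's quality (c
n)ⁿ·p² with WALDSCHMIDT 1980's binder (W + log V)·log V; verbatim the conclusion of the tree's
`Summit.ABC.StewartYu.YuNinetyW80.residueClass_of_w80Engine` (p428501) and the binder of the landed
door `Literature.Barriers.ABC.stewartYu1991_of_w80Shape` (p427924). Line (lead p2-g2, PATH Z,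
memo-04 §3): the K = ℚ Teichmüller-twist engine on the LANDED CW77/W80 architecture in log-p units
(PadicTwistSetup p428006, PadicTwistValues p428445 landed; Functions/Series/KStep/Main staged;
half-step provider A = QR-normalisation in ℚ_p; TwistW80Par; log-p sizes) ⇒ unit-form engine ⇒ this
text by `threeModFour_of_w80Engine` (tree). [difficulty: XL] -/
@[route_item "route-ABC-PadicPrimesW80TwoThirds", crux]
def W80ThreeModFour : Prop :=
  ∃ c₅ : ℝ, ∀ (p : ℕ), p.Prime → p % 4 = 3 → ∀ (S : Finset ℕ), (∀ q ∈ S, q.Prime) → p ∉ S → S.Nonempty → ∀ (e : ℕ → ℤ) (B : ℝ), 3 ≤ B → (∀ q ∈ S, (|e q| : ℝ) ≤ B) → ∏ q ∈ S, (q : ℚ) ^ e q ≠ 1 → (padicValRat p (∏ q ∈ S, (q : ℚ) ^ e q - 1) : ℝ) < (c₅ * S.card) ^ S.card * (p : ℝ) ^ 2 * ((Real.log B + Real.log (Real.log ((max 4 (S.sup id) : ℕ) : ℝ))) * Real.log (Real.log ((max 4 (S.sup id) : ℕ) : ℝ))) * ∏ q ∈ S, Real.log ((max 4 q : ℕ)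 : ℝ)

-- `W80ThreeModFour` holds: proved by `Summit.ABC.ABC.Theorems.padicPrimesW80TwoThirds_w80ThreeModFour_proof` (its module imports this route file, so no `_holds` link can be stated here).

/-- item stmt-ABC-19486 · crux · rank 3 · closed · proved by Summit.ABC.ABC.Cruxes.W80Two.TwoAdicThird.W80Two_of (prover) · by planner
why it might fail: The 2-adic engine is unbuilt (≈ 4–5 kLoC): radius-2 Schwarz constants (exp/log only on ord₂ ≥ 2/3... via squares ≡ 1 mod 8), the Siegel count and endgame numerics at p = 2 with 3^m classes and cubic norms may not close inside (c·n)ⁿ; generators qⱼ² cost 2ⁿ only.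
sources: Yu1990, StewartYu1991, Waldschmidt1980
[crux] there is c₅ such that at p = 2, every finite set S of primes q ≠ p (S ≠ ∅), exponents |e_q| ≤
B (B ≥ 3) with ∏q^(e_q) ≠ 1: ord_p(∏_{q∈S} q^(e_q) − 1) < (c₅·#S)^#S · p² · (log B + log log A)·log
log A · ∏_{q∈S} log max(4,q), A = max(4, max S) — Yu 1990's quality (c n)ⁿ·p² with WALDSCHMIDT
1980's binder (W + log V)·log V; verbatim the conclusion of the tree's
`Summit.ABC.StewartYu.YuNinetyW80.residueClass_of_w80Engine` (p428501) and the binder of the landed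
door `Literature.Barriers.ABC.stewartYu1991_of_w80Shape` (p427924). Line (WP-Y2 on the landed
architecture): principal units αⱼ = qⱼ² ≡ 1 (mod 8), q = 3 descent over ℚ (∛α ∈ ℤ₂ by Hensel; 3^m
classes; third-point Liouville by the cubic norm form — lit p421796/p424483, p1 bricks
p422573/p423648), f log p = log 2, then a 2-adic analogue of `residueClass_of_w80Engine`.
[difficulty: XL] -/
@[route_item "route-ABC-PadicPrimesW80TwoThirds", crux]
def W80Two : Prop :=
  ∃ c₅ : ℝ, ∀ (S : Finset ℕ), (∀ q ∈ S, q.Prime) → 2 ∉ S → S.Nonempty → ∀ (e : ℕ → ℤ) (B : ℝ), 3 ≤ B → (∀ q ∈ S, (|e q| : ℝ) ≤ B) → ∏ q ∈ S, (q : ℚ) ^ e q ≠ 1 → (padicValRat 2 (∏ q ∈ S, (q : ℚ) ^ e q - 1) : ℝ) < (c₅ * S.card) ^ S.card * (2 : ℝ) ^ 2 * ((Real.log B + Real.log (Real.log ((max 4 (S.sup id) : ℕ) : ℝ))) * Real.log (Real.log ((max 4 (S.sup id) : ℕ) : ℝ))) * ∏ q ∈ S, Real.log ((max 4 q : ℕ)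 : ℝ)

-- `W80Two` holds: proved by `Summit.ABC.ABC.Cruxes.W80Two.TwoAdicThird.W80Two_of` (its module imports this route file, so no `_holds` link can be stated here).

/-- item stmt-ABC-19487 · crux · rank 4 · closed · proved by Summit.ABC.ABC.Cruxes.W80OneModFour.ParityTwistW80.W80OneModFour_of (prover) · by planner
why it might fail: Same engine plus the half-step OUTSIDE ℚ_p (ξ² = ζ has no root in ℚ_p at p ≡ 1 mod 4): fails if the PadicComplex norm API cannot carry the half-step sizes inside the landed Main's HalfStep interface, or if the class-bit bookkeeping doubles T beyond the numerics.
sources: Yu1990, Waldschmidt1980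
[crux] there is c₅ such that for every prime p with p ≡ 1 (mod 4), every finite set S of primes q ≠
p (S ≠ ∅), exponents |e_q| ≤ B (B ≥ 3) with ∏q^(e_q) ≠ 1: ord_p(∏_{q∈S} q^(e_q) − 1) < (c₅·#S)^#S ·
p² · (log B + log log A)·log log A · ∏_{q∈S} log max(4,q), A = max(4, max S) — Yu 1990's quality (c
n)ⁿ·p² with WALDSCHMIDT 1980's binder (W + log V)·log V; verbatim the conclusion of the tree's
`Summit.ABC.StewartYu.YuNinetyW80.residueClass_of_w80Engine` (p428501) and the binder of the landed
door `Literature.Barriers.ABC.stewartYu1991_of_w80Shape` (p427924). Line: the same engine with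
p3-g2's parity-bit half-step outside ℚ_p (classes mod (p−1)/2 + one bit; Liouville over ℚ(ι,√α) in
ℂ_[p]: PadicComplexLiouville p425563, TwistHalfPointAlgebra p427086 landed) ⇒ text by
`oneModFour_of_w80Engine` (tree). [difficulty: L] -/
@[route_item "route-ABC-PadicPrimesW80TwoThirds", crux]
def W80OneModFour : Prop :=
  ∃ c₅ : ℝ, ∀ (p : ℕ), p.Prime → p % 4 = 1 → ∀ (S : Finset ℕ), (∀ q ∈ S, q.Prime) → p ∉ S → S.Nonempty → ∀ (e : ℕ → ℤ) (B : ℝ), 3 ≤ B → (∀ q ∈ S, (|e q| : ℝ) ≤ B) → ∏ q ∈ S, (q : ℚ) ^ e q ≠ 1 → (padicValRat p (∏ q ∈ S, (q : ℚ) ^ e q - 1) : ℝ) < (c₅ * S.card) ^ S.card * (p : ℝ) ^ 2 * ((Real.log B + Real.log (Real.log ((max 4 (S.sup id) : ℕ) : ℝ))) * Real.log (Real.log ((max 4 (S.sup id) : ℕ) : ℝ))) * ∏ q ∈ S, Real.log ((max 4 q : ℕ) : ℝ)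

-- `W80OneModFour` holds: proved by `Summit.ABC.ABC.Cruxes.W80OneModFour.ParityTwistW80.W80OneModFour_of` (its module imports this route file, so no `_holds` link can be stated here).

/-- item stmt-ABC-19488 · assembly · rank 1 · closed · proved by Summit.ABC.ABC.Theorems.padicPrimesW80TwoThirds_assembly_proof (prover) · by planner
sources: StewartYu1991
[assembly] W80ThreeModFour → W80OneModFour → W80Two → the rung leaf stewartYu1991_upperBound
(`closes_target`). [deps: W80ThreeModFour, W80OneModFour, W80Two] [difficulty: provable-now] -/
@[route_item "route-ABC-PadicPrimesW80TwoThirds"]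
def Assembly : Prop :=
  W80ThreeModFour → W80OneModFour → W80Two → Literature.Barriers.ABC.stewartYu1991_upperBound

-- `Assembly` holds: proved by `Summit.ABC.ABC.Theorems.padicPrimesW80TwoThirds_assembly_proof` (its module imports this route file, so no `_holds` link can be stated here).

/-! D-0027 §2.1 — DECIDING THEOREM (planner-authored via `route open/edit --closes-file`; by planner-abc-stewartyu-plan-g4-0 2026-08-26T06:44:19Z) — ARCHIVED: route closed (proved) 2026-08-26T14:14:11Z; kept so importers keep building:
its hypotheses are this route's items and its conclusion the registered leaf `Literature.Barriers.ABC.stewartYu1991_upperBound` (rung F-A1.M2, D-0061) (glue_lint), and it elaborates with this file. -/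

@[closes "route-ABC-PadicPrimesW80TwoThirds"] theorem closes (h₃ : W80ThreeModFour) (h₁ : W80OneModFour) (h₂ : W80Two) :
    Literature.Barriers.ABC.stewartYu1991_upperBound := by
  obtain ⟨c₃, H₃⟩ := h₃
  obtain ⟨c₁, H₁⟩ := h₁
  obtain ⟨c₂, H₂⟩ := h₂
  refine Literature.Barriers.ABC.stewartYu1991_of_w80Shape (max (max |c₃| |c₁|) |c₂|) ?_
  intro p hp S hS hpS hne e B hB heB hne1
  -- the tail of the bound is non-negative, so the constant may be enlarged
  have h4 : (4 : ℝ) ≤ ((max 4 (S.sup id) : ℕ) : ℝ) := by exact_mod_cast le_max_left _ _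
  have hlog4 : (1 : ℝ) ≤ Real.log ((max 4 (S.sup id) : ℕ) : ℝ) := by
    have he : Real.exp 1 ≤ 4 := by have := Real.exp_one_lt_d9; linarith
    calc (1 : ℝ) = Real.log (Real.exp 1) := (Real.log_exp 1).symm
      _ ≤ Real.log 4 := Real.log_le_log (Real.exp_pos 1) he
      _ ≤ _ := Real.log_le_log (by norm_num) h4
  have hT : 0 ≤ (p : ℝ) ^ 2 * ((Real.log B + Real.log (Real.log ((max 4 (S.sup id) : ℕ) : ℝ))) * Real.log (Real.log ((max 4 (S.sup id) : ℕ) : ℝ))) * ∏ q ∈ S, Real.log ((max 4 q : ℕ) : ℝ) := by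
    have hB' : 0 ≤ Real.log B := Real.log_nonneg (by linarith)
    have hLL : 0 ≤ Real.log (Real.log ((max 4 (S.sup id) : ℕ) : ℝ)) := Real.log_nonneg hlog4
    have hP : 0 ≤ ∏ q ∈ S, Real.log ((max 4 q : ℕ) : ℝ) :=
      Finset.prod_nonneg fun q _ => Real.log_nonneg (by exact_mod_cast le_max_of_le_left (by norm_num))
    positivity
  have mono : ∀ c : ℝ, |c| ≤ max (max |c₃| |c₁|) |c₂| → ∀ v : ℝ,
      v < (c * S.card) ^ S.card * (p : ℝ) ^ 2 * ((Real.log B + Real.log (Real.log ((max 4 (S.sup id) : ℕ) : ℝ))) * Real.log (Real.log ((max 4 (S.sup id) : ℕ) : ℝ))) * ∏ q ∈ S, Real.log ((max 4 q : ℕ) : ℝ) →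
      v < (max (max |c₃| |c₁|) |c₂| * S.card) ^ S.card * (p : ℝ) ^ 2 * ((Real.log B + Real.log (Real.log ((max 4 (S.sup id) : ℕ) : ℝ))) * Real.log (Real.log ((max 4 (S.sup id) : ℕ) : ℝ))) * ∏ q ∈ S, Real.log ((max 4 q : ℕ) : ℝ) := by
    intro c hc v hv
    have hpow : (c * S.card) ^ S.card ≤ (max (max |c₃| |c₁|) |c₂| * S.card) ^ S.card := by
      calc (c * S.card) ^ S.card ≤ |(c * S.card) ^ S.card| := le_abs_self _
        _ = (|c| * S.card) ^ S.card := by rw [abs_pow, abs_mul, Nat.abs_cast]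
        _ ≤ _ := pow_le_pow_left₀ (by positivity)
              (mul_le_mul_of_nonneg_right hc (Nat.cast_nonneg _)) _
    refine lt_of_lt_of_le hv ?_
    have := mul_le_mul_of_nonneg_right hpow hT
    calc (c * S.card) ^ S.card * (p : ℝ) ^ 2 * ((Real.log B + Real.log (Real.log ((max 4 (S.sup id) : ℕ) : ℝ))) * Real.log (Real.log ((max 4 (S.sup id) : ℕ) : ℝ))) * ∏ q ∈ S, Real.log ((max 4 q : ℕ) : ℝ)
        = (c * S.card) ^ S.card * ((p : ℝ) ^ 2 * ((Real.log B + Real.log (Real.log ((max 4 (S.sup id) : ℕ) : ℝ))) * Real.log (Real.log ((max 4 (S.sup id) : ℕ) : ℝ))) * ∏ q ∈ S, Real.log ((max 4 q : ℕ) : ℝ)) := by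
          ring
      _ ≤ (max (max |c₃| |c₁|) |c₂| * S.card) ^ S.card * ((p : ℝ) ^ 2 * ((Real.log B + Real.log (Real.log ((max 4 (S.sup id) : ℕ) : ℝ))) * Real.log (Real.log ((max 4 (S.sup id) : ℕ) : ℝ))) * ∏ q ∈ S, Real.log ((max 4 q : ℕ) : ℝ)) :=
          this
      _ = _ := by ring
  rcases hp.eq_two_or_odd with hp2 | hodd
  · subst hp2
    have h := H₂ S hS hpS hne e B hB heB hne1
    refine mono c₂ (le_max_right _ _) _ ?_
    simpa only [Nat.cast_ofNat] using h
  · have h13 : p % 4 = 1 ∨ p % 4 = 3 := by omega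
    rcases h13 with h1 | h3
    · exact mono c₁ ((le_max_right _ _).trans (le_max_left _ _)) _
        (H₁ p hp h1 S hS hpS hne e B hB heB hne1)
    · exact mono c₃ ((le_max_left _ _).trans (le_max_left _ _)) _
        (H₃ p hp h3 S hS hpS hne e B hB heB hne1)

end Summit.ABC.ABC.Theses.PadicPrimesW80TwoThirds
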